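import Summits.BirchSwinnertonDyer.BirchSwinnertonDyer.Theses.ResidualThetaTransportAtTwo
import Summits.BirchSwinnertonDyer.BirchSwinnertonDyer.Theorems.ResidualThetaTransportAtTwoThetaLayerLambdaCongruenceAtTwoOfSdBz
import HarnessLib

/-!
# Line `birth` for crux `ThetaLayerLambdaCongruenceAtTwo` (stmt-BirchSwinnertonDyer-20688, route ResidualThetaTransportAtTwo) —
# PROPOSED skeleton v13 (width seat bsd-wall-rtt-p3-w3 g9, 2026-08-28; for the LEAD to adopt or ignore — not registered by this seat):
# TWO PRINT stubs {SD, Bz} and nothing else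

WHY v13. Since v12 (`a2517385c1e14469`, stubs {PUB⁷, AU, item 21437}) three things landed:
* the node item 27436 `CuspSpanEvenAtTwoOdd` is CLOSED·proved (rtt-p3-w2 g5 `CuspSpanEvenAtTwoOdd_proof`, p643713, over rtt-p3-w4 g2's
  all-odd-rows induction) — so FLAT holds by `SignedMuAtTwo.flatMuZeroAtTwo_of_cuspSpanEvenAtTwoOdd` WITHOUT Abbes–Ullmo and WITHOUT item 21437;
* tp2-p1-w2 g5's ES-free, Serre-free plus line (`thetaLayerLambdaCongruenceAtTwo_of_sdBz_flatMuZeroAtTwo`, p637013);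
* this seat's compositions `thetaLayerLambdaCongruenceAtTwo_of_sdBz_cuspSpanEvenAtTwoOdd` (p643583) and
  `thetaLayerLambdaCongruenceAtTwo_of_sdBz : SD → Bz → Kan⁺` (`…ThetaLayerLambdaCongruenceAtTwoOfSdBz`).
Hence the crux BY NAME needs exactly the two print binders below; (AU), (ES), (Se), (D), (F), (MK) and the item 21437 all leave the skeleton.
STUBS (2 ≤ stubs_max; both PRINT, never prover targets; Literature-prover debt):
  (SD) `stub_pubHeckeSelfDual` — `heckeSelfDual_torsionBy_J0` (DDT 1995 Lemma 1.38 mod ℓ); itself ⟸ the integral pairing fact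
       `periodHomology_exists_heckeSelfAdjoint_perfectPairing` by the landed `heckeSelfDual_torsionBy_J0_of_perfectPairing`.
  (Bz) `stub_pubBuzzard` — `buzzard2000_multiplicityOne_gamma0` (Buzzard 2000 Prop. 2.4).
Composition `ThetaLayerLambdaCongruenceAtTwo_of := thetaLayerLambdaCongruenceAtTwo_of_sdBz stub_pubHeckeSelfDual stub_pubBuzzard`.
BSD is not proved by any of this; the crux is a theorem CONDITIONAL on two published facts.
-/

set_option autoImplicit false
-- justification: the `Summit.BirchSwinnertonDyer.BirchSwinnertonDyer.…` path repeats a component (route-file convention)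
set_option linter.dupNamespace false

noncomputable section

namespace Summit.BirchSwinnertonDyer.BirchSwinnertonDyer.Cruxes.ThetaLayerLambdaCongruenceAtTwo.Birth

/-- stub (SD) — PRINT: Hecke self-duality of `J₀(N)[ℓ]` (Darmon–Diamond–Taylor 1995, Lemma 1.38 reduced mod `ℓ`), the tree's Literature
named fact BY NAME. Literature debt (⟸ the `w_N`-twisted intersection pairing on `H₁(X₀(N); ℤ)`, reduction landed); never staffed by provers. -/
theorem stub_pubHeckeSelfDual :
    Literature.NumberTheory.EllipticCurves.ModularForms.heckeSelfDual_torsionBy_J0 := by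
  sorry

/-- stub (Bz) — PRINT: Buzzard 2000 Prop. 2.4 (mod-`2` multiplicity one on `Γ₀(N)`, `N` odd, `ρ̄` irreducible and non-scalar on `D₂`), the
tree's Literature named fact BY NAME. Literature debt; never staffed by provers. -/
theorem stub_pubBuzzard :
    Literature.NumberTheory.EllipticCurves.ModularForms.buzzard2000_multiplicityOne_gamma0 := by
  sorry

/-- THE SKELETON THEOREM (registrar shape): the crux BY NAME from the two declared print stubs through the LANDED sorry-free
composition `thetaLayerLambdaCongruenceAtTwo_of_sdBz` (node 27436 closed; plus line free of ES, Se and AU). -/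
theorem ThetaLayerLambdaCongruenceAtTwo_of :
    Summit.BirchSwinnertonDyer.BirchSwinnertonDyer.Theses.ResidualThetaTransportAtTwo.ThetaLayerLambdaCongruenceAtTwo :=
  Summit.BirchSwinnertonDyer.BirchSwinnertonDyer.Theorems.ThetaLayerLambdaCongruenceAtTwo.thetaLayerLambdaCongruenceAtTwo_of_sdBz
    stub_pubHeckeSelfDual stub_pubBuzzard

end Summit.BirchSwinnertonDyer.BirchSwinnertonDyer.Cruxes.ThetaLayerLambdaCongruenceAtTwo.Birth

end
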